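import Mathlib
import Literature.AlgebraicGeometry.Resolution.CobordantGame
import Literature.AlgebraicGeometry.Resolution.CobordantVertexChart
import Literature.AlgebraicGeometry.Resolution.CobordantArcLemma
import Summits.ResolutionOfSingularities.ResolutionOfSingularities.Theorems.WeightedInvariantLocalWeightedDropGradedSliceTwistedSuccessor
import Summits.ResolutionOfSingularities.ResolutionOfSingularities.Theorems.WeightedInvariantLocalWeightedDropGradedSliceTwistedSaturation
import Summits.ResolutionOfSingularities.ResolutionOfSingularities.Theorems.WeightedInvariantLocalWeightedDropGradedSliceWildRankZero

/-!
# `WeightedInvariant.LocalWeightedDrop`: the wild slice clause — POINTWISE SATURATION: the successor step with the re-centring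
# chosen at the successor point

Route `ResolutionOfSingularities/WeightedInvariant`, crux `LocalWeightedDrop` (stmt-ResolutionOfSingularities-8899).
[OURS · L1 W4.3] — res-type-060 (gen 10), WILD LIBRARY file 19; refines file 16 (`…GradedSliceTwistedSuccessor`, p530999) from UNIFORM
to POINTWISE saturation, using res-type-099's ORBIT SUBSTITUTION `orbitSubst` (p529199) in two roles.  Nothing here is a statement of
the manuscript under review on ladder RESOLUTION; not a verdict on card A.  AI proof, weaker than expert review.

## What is proved
* §1 **`isSuccessorAt_of_frobCover`** — the SATURATION-FREE successor correspondence (positive packaging of res-type-099's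
  `not_isSuccessorAt_of_frobCover`, p529887): if TC(GΘ, H, τ, a) (`GΘ(…, y^q) = (1+y)ᵃ · H((1+y)^τ x)`), then EVERY singular
  `s`-saturated successor `S` of `GΘ` under `(id, (W, 0))` at `(c', ·)` with exponent `A` lies over a singular `s`-saturated successor
  `h₁` of `H` under `(id, W)` at `c'` with the SAME exponent, and on the cover `S(…, y^q) = (1+y)ᵃ · h₁(𝒪_τ)` — the TRANSLATION-TYPE
  structure (`𝒪_τ` = `orbitSubst τ W c'` re-centres the translated coordinates along `(1+y)^{τ_m}(c'_m + z_m) − c'_m`).  No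
  congruence on `τ` is needed for this much.
* §2 The DOWNSTAIRS RE-CENTRING at a point: `Fin.snoc (orbitSubst K W c') (X last)` — zero constants, linear part of determinant `1`,
  GRADED for every lattice in which the idle coordinate and the translated coordinates have trivial character; and it INTERTWINES the
  downstairs pre-scaling `xⱼ ↦ (1+y)^{Kⱼ}xⱼ` (file 17) with the chart of `(id,(W,0))`:
  `(G ∘ D_K)(chart) = (G(chart)) ∘ (𝒪_K ⊔ y)` (`subst_cruxChart_subst_snoc_scaleFam`).
* §3 **`isSuccessorAt_of_twistedCyl_pointwise`** — under TC(G, h, τ, a) and POINTWISE saturation at the point `c'`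
  (`(τ + q·K)ⱼ = m·Wⱼ` on the translated coordinates of `c'`, `m·Wⱼ ≤ (τ + q·K)ⱼ` on the blown-up ones — the data produced by file 17's
  `exists_exact_saturation` from a mere congruence `τⱼ ≡ m₀·Wⱼ (mod q)` on the translated coordinates of `c'`), every singular
  successor `G₁` of `G` at `(c', ·)` comes from a singular successor `h₁` of `h` at `c'` with the same exponent, and the RE-CENTRED
  successor `G₁ ∘ (𝒪_K ⊔ y)` is again a twisted cylinder: **TC(G₁ ∘ (𝒪_K ⊔ y), h₁, succTau (τ + q·K) W m, a + m·A)**.  Since the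
  re-centring is a graded invertible coordinate change, graded wins of `G₁` and of its re-centring are the same (p527298): the same-rank
  induction (file 20) therefore needs saturation only AT THE POINTS CARRYING A SINGULAR SUCCESSOR OF THE SLICE, each with its own `m`.
-/

set_option linter.dupNamespace false -- mandated namespace of this single-conjunct summit
set_option autoImplicit false

namespace Summit.ResolutionOfSingularities.ResolutionOfSingularities.Theorems

namespace GradedGame

open MvPowerSeries
open Literature.AlgebraicGeometry.Resolution
open Literature.AlgebraicGeometry.Resolution.FormalCoordChange (linMat)

variable {k : Type} [Field k]

/-! ## §1 The saturation-free successor correspondence (translation type) -/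

section FrobCover

variable {n : ℕ}

/-- **EVERY SINGULAR SUCCESSOR OF A TWISTED CYLINDER LIES OVER A SINGULAR SUCCESSOR OF ITS SLICE** (same point, same exponent), and on
the Frobenius cover it is the orbit-substitution image of it: `S(…, y^q) = (1+y)ᵃ · h₁(𝒪_τ)`.  No congruence on `τ` is assumed (the
structure is of translation type in general).  Positive packaging of res-type-099's `not_isSuccessorAt_of_frobCover`. [OURS · L1 W4.3] -/
theorem isSuccessorAt_of_frobCover (q : ℕ) (hq : 0 < q) (τ : Fin (n + 1) → ℕ) (a : ℕ)
    (GΘ : MvPowerSeries (Fin (n + 1 + 1)) k) (H : MvPowerSeries (Fin (n + 1)) k)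
    (hkey : subst (frobFamily (k := k) n q) GΘ = (1 + X (Fin.last (n + 1))) ^ a * subst (scaleFam (k := k) τ) H)
    (W : Fin (n + 1) → ℕ) (cb : Fin (n + 1 + 1) → k) (A : ℕ) (S : MvPowerSeries (Fin (n + 1 + 1 + 1)) k)
    (hS : IsSuccessorAt GΘ (fun i => X i) (Fin.snoc W 0 : Fin (n + 1 + 1) → ℕ) cb A S) :
    ∃ h₁ : MvPowerSeries (Fin (n + 1 + 1)) k, IsSuccessorAt H (fun i => X i) W (fun m => cb (Fin.castSucc m)) A h₁ ∧
      subst (frobFamily (k := k) (n + 1) q) S =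
        (1 + X (Fin.last (n + 1 + 1))) ^ a * subst (orbitSubst (k := k) τ W (fun m => cb (Fin.castSucc m))) h₁ := by
  classical
  obtain ⟨⟨i, hwi, hci⟩, hfac, hndvd, hsing⟩ := hS
  set c' : Fin (n + 1) → k := fun m => cb (Fin.castSucc m) with hc'
  have hoff : ∃ i, 0 < W i ∧ c' i ≠ 0 := by
    revert hwi hci
    refine Fin.lastCases ?_ (fun i' => ?_) i
    · intro hwi; simp at hwi
    · intro hwi hci
      rw [Fin.snoc_castSucc] at hwi
      exact ⟨i', hwi, hci⟩
  set Ch := CobordantGame.cruxChart k (Fin.snoc W 0 : Fin (n + 1 + 1) → ℕ) cb with hCh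
  have hChs : HasSubst Ch := hasSubst_cruxChart _ cb
  have hF's := hasSubst_frobFamily (k := k) (n := n + 1) q hq
  have hself : subst (fun i : Fin (n + 1 + 1) => (X i : MvPowerSeries (Fin (n + 1 + 1)) k)) GΘ = GΘ := by
    rw [show (fun i : Fin (n + 1 + 1) => (X i : MvPowerSeries (Fin (n + 1 + 1)) k)) = X from rfl, subst_self]; rfl
  rw [hself] at hfac
  have hChlast : Ch (Fin.last (n + 1)) = X (Fin.last (n + 1 + 1)) := by rw [hCh, cruxChart_snoc_zero_last]
  -- pull the factorisation back to the cover: `s^A · S(…, y^q) = (1+y)ᵃ · (H(chart^W_{c'}))(𝒪)`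
  have hcov : X 0 ^ A * subst (frobFamily (k := k) (n + 1) q) S =
      (1 + X (Fin.last (n + 1 + 1))) ^ a * subst (orbitSubst (k := k) τ W c') (subst (CobordantGame.cruxChart k W c') H) := by
    have h := congrArg (subst (frobFamily (k := k) (n + 1) q)) hfac
    rw [subst_mul hF's, subst_pow hF's, subst_X hF's,
      frobFamily_of_ne_last q (n + 1) 0 (Fin.castSucc_lt_last (0 : Fin (n + 1 + 1))).ne,
      subst_frobFamily_cruxChart_comm q W cb hq, hkey, subst_one_add_X_pow_mul hChs, hChlast,
      subst_comp_subst_apply (hasSubst_scaleFam τ) hChs] at h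
    rw [← h, subst_comp_subst_apply (hasSubst_cruxChart W c') (hasSubst_orbitSubst τ W c')]
    congr 2
    funext m
    have h1 : subst Ch (1 : MvPowerSeries (Fin (n + 1 + 1)) k) = 1 := subst_one' hChs
    rw [scaleFam_apply, subst_mul hChs, subst_pow hChs, subst_add hChs, h1, subst_X hChs, subst_X hChs, hChlast,
      subst_orbitSubst_cruxChart τ W c' cb (fun m => rfl) m]
  set HC := subst (CobordantGame.cruxChart k W c') H with hHC
  have hU : IsUnit (((1 : MvPowerSeries (Fin (n + 1 + 1 + 1)) k) + X (Fin.last (n + 1 + 1))) ^ a) := by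
    refine IsUnit.pow a (isUnit_iff_constantCoeff.mpr ?_)
    simp [constantCoeff_X]
  have hHC0 : HC ≠ 0 := by
    intro hHC0
    rw [hHC0, subst_zero' (hasSubst_orbitSubst τ W c'), mul_zero] at hcov
    have hS0 : subst (frobFamily (k := k) (n + 1) q) S = 0 := by
      rcases mul_eq_zero.mp hcov with h | h
      · exact absurd h (pow_ne_zero _ X_zero_ne_zero)
      · exact h
    exact not_X_dvd_subst_frobFamily (n + 1) q hq hndvd (hS0 ▸ dvd_zero _)
  obtain ⟨A', h₁, hfac₁, hnd₁⟩ := CobordantVertexChart.exists_eq_X_pow_mul_not_dvd hHC0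
  rw [hfac₁, subst_mul (hasSubst_orbitSubst τ W c'), subst_pow (hasSubst_orbitSubst τ W c'), subst_X (hasSubst_orbitSubst τ W c')]
    at hcov
  have hO0 : orbitSubst (k := k) τ W c' 0 = X 0 := by simp [orbitSubst]
  rw [hO0] at hcov
  have hcov' : X 0 ^ A * subst (frobFamily (k := k) (n + 1) q) S =
      X 0 ^ A' * ((1 + X (Fin.last (n + 1 + 1))) ^ a * subst (orbitSubst (k := k) τ W c') h₁) := by rw [hcov]; ring
  obtain ⟨hAA, hSO⟩ := eq_of_X_pow_mul_eq hcov' (not_X_dvd_subst_frobFamily (n + 1) q hq hndvd)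
    (not_X_dvd_unit_mul hU (not_X_dvd_subst_orbitSubst τ W c' hnd₁))
  subst hAA
  have hXH : subst (fun i : Fin (n + 1) => (X i : MvPowerSeries (Fin (n + 1)) k)) H = H := by
    rw [show (fun i : Fin (n + 1) => (X i : MvPowerSeries (Fin (n + 1)) k)) = X from rfl, subst_self]; rfl
  refine ⟨h₁, ⟨hoff, by rw [hXH]; exact hfac₁, hnd₁, ?_⟩, hSO⟩
  -- singularity descends: `S ∈ 𝔪² ⇒ S(…, y^q) ∈ 𝔪² ⇒ h₁(𝒪) ∈ 𝔪² ⇒ h₁ ∈ 𝔪²`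
  by_contra hns
  have hS' := singular_subst_frobFamily (n + 1) q hq hsing
  rw [hSO, singular_iff_two_le_order, two_le_order_unit_mul_iff hU, ← singular_iff_two_le_order] at hS'
  exact not_singular_subst_orbitSubst τ W c' hns hS'

end FrobCover

/-! ## §2 The downstairs re-centring at a point: `𝒪_K ⊔ (y ↦ y)` -/

section Recentre

variable {n : ℕ} (K : Fin (n + 1) → ℕ) (W : Fin (n + 1) → ℕ) (c' : Fin (n + 1) → k)

/-- The re-centring on the old variables. [OURS · L1 W4.3] -/
theorem snoc_orbitSubst_castSucc (J : Fin (n + 1 + 1)) :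
    (Fin.snoc (orbitSubst (k := k) K W c') (X (Fin.last (n + 1 + 1))) :
      Fin (n + 1 + 1 + 1) → MvPowerSeries (Fin (n + 1 + 1 + 1)) k) (Fin.castSucc J) = orbitSubst (k := k) K W c' J := by
  rw [Fin.snoc_castSucc]

/-- … and on the idle coordinate. [OURS · L1 W4.3] -/
theorem snoc_orbitSubst_last :
    (Fin.snoc (orbitSubst (k := k) K W c') (X (Fin.last (n + 1 + 1))) :
      Fin (n + 1 + 1 + 1) → MvPowerSeries (Fin (n + 1 + 1 + 1)) k) (Fin.last (n + 1 + 1)) = X (Fin.last (n + 1 + 1)) := by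
  rw [Fin.snoc_last]

/-- The re-centring has zero constant terms. [OURS · L1 W4.3] -/
theorem constantCoeff_snoc_orbitSubst (i : Fin (n + 1 + 1 + 1)) :
    constantCoeff ((Fin.snoc (orbitSubst (k := k) K W c') (X (Fin.last (n + 1 + 1))) :
      Fin (n + 1 + 1 + 1) → MvPowerSeries (Fin (n + 1 + 1 + 1)) k) i) = 0 := by
  refine Fin.lastCases ?_ (fun J => ?_) i
  · rw [snoc_orbitSubst_last]; exact constantCoeff_X _
  · rw [snoc_orbitSubst_castSucc]; exact constantCoeff_orbitSubst K W c' J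

/-- … hence is substitutable. [OURS · L1 W4.3] -/
theorem hasSubst_snoc_orbitSubst :
    HasSubst (Fin.snoc (orbitSubst (k := k) K W c') (X (Fin.last (n + 1 + 1))) :
      Fin (n + 1 + 1 + 1) → MvPowerSeries (Fin (n + 1 + 1 + 1)) k) :=
  hasSubst_of_constantCoeff_zero (constantCoeff_snoc_orbitSubst K W c')

/-- The linear part of the re-centring has determinant `1` (identity off the idle column; Laplace along the idle row). [OURS · L1 W4.3] -/
theorem det_linMat_snoc_orbitSubst :
    (linMat (Fin.snoc (orbitSubst (k := k) K W c') (X (Fin.last (n + 1 + 1))) :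
      Fin (n + 1 + 1 + 1) → MvPowerSeries (Fin (n + 1 + 1 + 1)) k)).det = 1 := by
  classical
  set M : Matrix (Fin (n + 1 + 1 + 1)) (Fin (n + 1 + 1 + 1)) k :=
    linMat (Fin.snoc (orbitSubst (k := k) K W c') (X (Fin.last (n + 1 + 1))) :
      Fin (n + 1 + 1 + 1) → MvPowerSeries (Fin (n + 1 + 1 + 1)) k) with hM
  have hMap : ∀ a b, M a b = coeff (Finsupp.single b 1) ((Fin.snoc (orbitSubst (k := k) K W c') (X (Fin.last (n + 1 + 1))) :
      Fin (n + 1 + 1 + 1) → MvPowerSeries (Fin (n + 1 + 1 + 1)) k) a) := fun a b => rfl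
  have hlast : ∀ b, M (Fin.last (n + 1 + 1)) b = if b = Fin.last (n + 1 + 1) then 1 else 0 := by
    intro b
    rw [hMap, snoc_orbitSubst_last, coeff_X]
    by_cases hb : b = Fin.last (n + 1 + 1)
    · subst hb; simp
    · rw [if_neg hb, if_neg]
      exact fun h' => hb ((Finsupp.single_left_inj one_ne_zero).mp h')
  have hsub : M.submatrix (Fin.last (n + 1 + 1)).succAbove (Fin.last (n + 1 + 1)).succAbove = 1 := by
    ext a b
    rw [Matrix.submatrix_apply, Fin.succAbove_last, hMap, snoc_orbitSubst_castSucc,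
      coeff_single_castSucc_orbitSubst, Matrix.one_apply]
  rw [Matrix.det_succ_row M (Fin.last (n + 1 + 1)), Finset.sum_eq_single (Fin.last (n + 1 + 1))]
  · rw [hlast, if_pos rfl, hsub, Matrix.det_one, mul_one, Even.neg_one_pow ⟨(Fin.last (n + 1 + 1) : ℕ), rfl⟩, one_mul]
  · intro b _ hb
    rw [hlast, if_neg hb, mul_zero, zero_mul]
  · intro h; exact absurd (Finset.mem_univ _) h

/-- … so it is invertible. [OURS · L1 W4.3] -/
theorem isUnit_det_linMat_snoc_orbitSubst :
    IsUnit (linMat (Fin.snoc (orbitSubst (k := k) K W c') (X (Fin.last (n + 1 + 1))) :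
      Fin (n + 1 + 1 + 1) → MvPowerSeries (Fin (n + 1 + 1 + 1)) k)).det := by
  rw [det_linMat_snoc_orbitSubst]; exact isUnit_one

/-- The re-centring is GRADED for every lattice in which the idle coordinate and the translated coordinates of `c'` have trivial
character. [OURS · L1 W4.3] -/
theorem snoc_orbitSubst_graded (Lt : AddSubgroup (Fin (n + 1 + 1 + 1) → ℤ))
    (hlast : (Pi.single (Fin.last (n + 1 + 1)) 1 : Fin (n + 1 + 1 + 1) → ℤ) ∈ Lt)
    (htr : ∀ m : Fin (n + 1), c' m ≠ 0 → 0 < W m → (Pi.single (Fin.castSucc m.succ) 1 : Fin (n + 1 + 1 + 1) → ℤ) ∈ Lt) :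
    ∀ i (e : Fin (n + 1 + 1 + 1) →₀ ℕ),
      coeff e ((Fin.snoc (orbitSubst (k := k) K W c') (X (Fin.last (n + 1 + 1))) :
        Fin (n + 1 + 1 + 1) → MvPowerSeries (Fin (n + 1 + 1 + 1)) k) i) ≠ 0 → expVec e - Pi.single i 1 ∈ Lt := by
  intro i
  refine Fin.lastCases ?_ (fun J => ?_) i
  · rw [snoc_orbitSubst_last]; exact homDeg_X Lt _
  · rw [snoc_orbitSubst_castSucc]
    refine Fin.cases ?_ (fun m => ?_) J
    · intro e he
      simp only [orbitSubst, Fin.cases_zero] at he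
      exact homDeg_X Lt _ e he
    · intro e he
      simp only [orbitSubst, Fin.cases_succ] at he
      by_cases hW : 0 < W m
      · rw [if_pos hW] at he
        by_cases hc : c' m = 0
        · rw [hc, map_zero, zero_add, sub_zero] at he
          have h := homDeg_mul Lt (homDeg_one_add_X_pow Lt _ hlast (K m)) (homDeg_X Lt (Fin.castSucc m.succ)) e he
          rwa [zero_add] at h
        · have hm := htr m hc hW
          by_cases he0 : e = 0
          · subst he0
            rw [expVec_zero, zero_sub]
            exact Lt.neg_mem hm
          · have he' : coeff e (((1 : MvPowerSeries (Fin (n + 1 + 1 + 1)) k) + X (Fin.last (n + 1 + 1))) ^ (K m) *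
                (C (c' m) + X (Fin.castSucc m.succ))) ≠ 0 := by
              rwa [map_sub, coeff_C, if_neg he0, sub_zero] at he
            have h := homDeg_mul Lt (homDeg_one_add_X_pow Lt _ hlast (K m)) (homDeg_C_add_X Lt (Fin.castSucc m.succ) hm (c' m)) e he'
            rw [add_zero, sub_zero] at h
            have : expVec e - Pi.single (Fin.castSucc m.succ) 1 = expVec e + (-(Pi.single (Fin.castSucc m.succ) 1)) :=
              sub_eq_add_neg _ _
            rw [this]
            exact Lt.add_mem h (Lt.neg_mem hm)
      · rw [if_neg hW] at he
        have h := homDeg_mul Lt (homDeg_one_add_X_pow Lt _ hlast (K m)) (homDeg_X Lt (Fin.castSucc m.succ)) e he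
        rwa [zero_add] at h

/-- **THE RE-CENTRING INTERTWINES THE PRE-SCALING WITH THE CHART**: for the downstairs scaling `D_K = (xⱼ ↦ (1+y)^{Kⱼ}xⱼ, y ↦ y)` of
file 17 and every exceptional point `cb` of the move `(id, (W, 0))`: `chartⱼ(D_K) = (𝒪_K ⊔ y)(chartⱼ)` componentwise, hence
`(G ∘ D_K)(chart) = (G(chart))(𝒪_K ⊔ y)`. [OURS · L1 W4.3] -/
theorem subst_cruxChart_subst_snoc_scaleFam (cb : Fin (n + 1 + 1) → k) (hc : ∀ m, cb (Fin.castSucc m) = c' m)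
    (G : MvPowerSeries (Fin (n + 1 + 1)) k) :
    subst (CobordantGame.cruxChart k (Fin.snoc W 0 : Fin (n + 1 + 1) → ℕ) cb)
        (subst (Fin.snoc (scaleFam (k := k) K) (X (Fin.last (n + 1)))) G) =
      subst (Fin.snoc (orbitSubst (k := k) K W c') (X (Fin.last (n + 1 + 1))))
        (subst (CobordantGame.cruxChart k (Fin.snoc W 0 : Fin (n + 1 + 1) → ℕ) cb) G) := by
  obtain rfl : c' = fun j => cb (Fin.castSucc j) := (funext hc).symm
  have hC := hasSubst_cruxChart (k := k) (Fin.snoc W 0 : Fin (n + 1 + 1) → ℕ) cb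
  have hD := hasSubst_snoc_scaleFam (k := k) K
  have hO := hasSubst_snoc_orbitSubst (k := k) K W (fun j => cb (Fin.castSucc j))
  rw [subst_comp_subst_apply hD hC, subst_comp_subst_apply hC hO]
  congr 1
  funext i
  refine Fin.lastCases ?_ (fun m => ?_) i
  · rw [snoc_scaleFam_last, subst_X hC, cruxChart_snoc_zero_last, subst_X hO, snoc_orbitSubst_last]
  · rw [snoc_scaleFam_castSucc, subst_mul hC, subst_pow hC, subst_add hC, subst_one' hC, subst_X hC, subst_X hC,
      cruxChart_snoc_zero_last]
    conv_rhs => rw [cruxChart_snoc_castSucc, subst_cylinder hO]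
    have hfam : (fun j : Fin (n + 1 + 1) => (Fin.snoc (orbitSubst (k := k) K W fun j => cb (Fin.castSucc j)) (X (Fin.last (n + 1 + 1))) :
        Fin (n + 1 + 1 + 1) → MvPowerSeries (Fin (n + 1 + 1 + 1)) k) (Fin.castSucc j)) =
        orbitSubst (k := k) K W fun j => cb (Fin.castSucc j) := by
      funext j; rw [Fin.snoc_castSucc]
    rw [hfam, subst_orbitSubst_cruxChart K W _ cb (fun m => rfl) m]

end Recentre

/-! ## §3 The successor step under POINTWISE saturation -/

section Pointwise

variable {n : ℕ} (q : ℕ) (τ : Fin (n + 1) → ℕ) (a : ℕ) (W : Fin (n + 1) → ℕ) (γ : Fin (n + 1 + 1) → k) (m : ℕ)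
  (K : Fin (n + 1) → ℕ)

/-- **SUCCESSORS OF A TWISTED CYLINDER UNDER POINTWISE SATURATION.**  TC(G, h, τ, a); a point `γ` of the move `(id, (W,0))`; data
`m, K` with `(τ + q·K)ⱼ = m·Wⱼ` on the TRANSLATED coordinates of `γ` and `m·Wⱼ ≤ (τ + q·K)ⱼ` on the blown-up ones (file 17's
`exists_exact_saturation` produces them from a congruence `τⱼ ≡ m₀·Wⱼ (mod q)` on the translated coordinates of `γ` alone).  Then
every singular successor `G₁` of `G` at `γ` with exponent `A` comes from a singular successor `h₁` of `h` at `γ|_{old}` with the same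
exponent, and the RE-CENTRED successor is a twisted cylinder over it: TC(G₁ ∘ (𝒪_K ⊔ y), h₁, succTau (τ + q·K) W m, a + m·A).
[OURS · L1 W4.3] -/
theorem isSuccessorAt_of_twistedCyl_pointwise (hq : 0 < q)
    (hfrob : ((1 : MvPowerSeries (Fin (n + 1 + 1)) k) + X (Fin.last (n + 1))) ^ q = 1 + X (Fin.last (n + 1)) ^ q)
    (h : MvPowerSeries (Fin (n + 1)) k) (G : MvPowerSeries (Fin (n + 1 + 1)) k)
    (hTC : subst (frobFamily (k := k) n q) G = (1 + X (Fin.last (n + 1))) ^ a * subst (scaleFam (k := k) τ) h)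
    (hex : ∀ j, γ (Fin.castSucc j) ≠ 0 → 0 < W j → (τ + q • K) j = m * W j)
    (hdom : ∀ j, 0 < W j → m * W j ≤ (τ + q • K) j)
    (A : ℕ) (G₁ : MvPowerSeries (Fin (n + 1 + 1 + 1)) k)
    (hS : IsSuccessorAt G (fun i => X i) (Fin.snoc W 0 : Fin (n + 1 + 1) → ℕ) γ A G₁) :
    ∃ h₁ : MvPowerSeries (Fin (n + 1 + 1)) k, IsSuccessorAt h (fun i => X i) W (fun l => γ (Fin.castSucc l)) A h₁ ∧
      subst (frobFamily (k := k) (n + 1) q)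
          (subst (Fin.snoc (orbitSubst (k := k) K W (fun l => γ (Fin.castSucc l))) (X (Fin.last (n + 1 + 1)))) G₁) =
        (1 + X (Fin.last (n + 1 + 1))) ^ (a + m * A) * subst (scaleFam (k := k) (succTau (τ + q • K) W m)) h₁ := by
  set c' : Fin (n + 1) → k := fun l => γ (Fin.castSucc l) with hc'
  -- the slice's successor at `c'`, from the saturation-free correspondence
  obtain ⟨h₁, hS₁, -⟩ := isSuccessorAt_of_frobCover q hq τ a G h hTC W γ A G₁ hS
  refine ⟨h₁, hS₁, ?_⟩
  obtain ⟨-, hfac₁, hnd₁, -⟩ := hS₁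
  have hXh : subst (fun i : Fin (n + 1) => (X i : MvPowerSeries (Fin (n + 1)) k)) h = h := by
    rw [show (fun i : Fin (n + 1) => (X i : MvPowerSeries (Fin (n + 1)) k)) = X from rfl, subst_self]; rfl
  rw [hXh] at hfac₁
  obtain ⟨-, hfac, -, -⟩ := hS
  have hXG : subst (fun i : Fin (n + 1 + 1) => (X i : MvPowerSeries (Fin (n + 1 + 1)) k)) G = G := by
    rw [show (fun i : Fin (n + 1 + 1) => (X i : MvPowerSeries (Fin (n + 1 + 1)) k)) = X from rfl, subst_self]; rfl
  rw [hXG] at hfac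
  -- the pre-scaled position `G ∘ D_K` is a twisted cylinder with exponents `τ + q·K`, exactly saturated at `γ`
  have hTC' := twistedCyl_upScale q τ a K hq hfrob h G hTC
  have hid := subst_frobFamily_cruxChart_of_twistedCyl q (τ + q • K) a W γ m hq h _ hTC' hex hdom A h₁ hfac₁
  -- `(G ∘ D_K)(chart) = (G(chart)) ∘ (𝒪_K ⊔ y) = s^A · G₁ ∘ (𝒪_K ⊔ y)`
  have hO := hasSubst_snoc_orbitSubst (k := k) K W c'
  have hF' := hasSubst_frobFamily (k := k) (n := n + 1) q hq
  rw [subst_cruxChart_subst_snoc_scaleFam K W c' γ (fun m => rfl), hfac, subst_mul hO, subst_pow hO, subst_X hO,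
    show (Fin.snoc (orbitSubst (k := k) K W c') (X (Fin.last (n + 1 + 1))) :
      Fin (n + 1 + 1 + 1) → MvPowerSeries (Fin (n + 1 + 1 + 1)) k) 0 = X 0 by
        rw [← Fin.castSucc_zero, Fin.snoc_castSucc]; simp [orbitSubst],
    subst_mul hF', subst_pow hF', subst_X hF',
    frobFamily_of_ne_last q (n + 1) 0 (Fin.castSucc_lt_last (0 : Fin (n + 1 + 1))).ne] at hid
  exact mul_left_cancel₀ (pow_ne_zero A X_zero_ne_zero) hid

end Pointwise

end GradedGame

end Summit.ResolutionOfSingularities.ResolutionOfSingularities.Theorems
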